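import Summits.QuantumFields.YangMills.Theorems.UnitScaleTiltFluctuationComparisonRegPrTwoCutoffKerHeightFree
import HarnessLib

/-!
# `UnitScaleTiltFluctuationComparisonRegPrTwoCutoffRefCfgCoherent` — THE COHERENT REFERENCE CONFIGURATION FUNCTIONAL OF 3⁗χ FROM A ONE-FAMILY TWO-RUN ROW:
# `∃ BR, RefCfgCoherent BR ∧ CfgRefOwnΦ …` CONSTRUCTED (crux `FluctuationComparisonRegPrIntL`, stmt-QuantumFields-20520, STUB 3⁗χ `stub_globalTwoRunSlackFamChi`; cell `pub/ym-inputs`,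
# INPUT-LIST I-11 row p10, seat ym-inputs-p10 g2, file 3; count-neutral helper, def-free)

WHY.  Files 1–2 (`…TwoCutoffTowerLimit`, `…TwoCutoffKerHeightFree`) construct the height-free reference CHART family of (R1) from a one-family two-run kernel row.  The per-run socket
`K1aLegRowsRefChi` (`…KernelLegRef` §3) has a SECOND reference object: a configuration functional `BR` with `RefCfgCoherent BR` (run `K+1`'s reference loop variable at
`(j+1, refineSet Y)` on the matched bond, read at the height-`n` field, IS run `K`'s at `(j, Y)`) and the per-run row `CfgRefΦ` / own-indexed `CfgRefOwnΦ` (`…KernelLegRefOwn` §3),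
consumed by `cfgDistCauchyΦ_of_ref` / `cfgRefΦ_of_own` / `cfgRefΦ_canonCore_of_own` — and, as for `Ψ`, nothing in the tree produces a `BR`.  This file produces it from the two-run row
`CfgDistCauchyΦ D B dist b₀ p₀ a C_B` of ONE configuration family `B`, by file 1's `exists_coherent_family` on the tower
`(K, k, j, Y, W, c) ↦ (K+1, k+1, j+1, refineSet Y, fieldShift W, matchBond c)` (run, lattice level, chart index, domain, level-`k` field, bond) with CONSTANT fibre `𝕍` and identity
pull-backs: along it the row's budget `C_B·(1+d(c))·θ(n)·(L^{−(K−n−1−j)})²·(L^{−(1+j)})^a` keeps `n = K − k`, `d(c)` (`DistMatched`) and `K − n − 1 − j`, and decays by `(L⁻¹)^a`.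

* §1 bookkeeping: `cfgFam_level_congr` (a configuration family read at `fieldShift`ed fields does not see through which propositionally-equal level index it is addressed —
  `subst`), the budget step `cfgBudget_step_eq`.
* §2 **`exists_refCfgCoherent_of_twoRun`**: `LocMatched D`, `DistMatched dist`, `1 < L`, `0 < a`, `CompleteSpace 𝕍` and the one-family row `CfgDistCauchyΦ D B dist b₀ p₀ a C_B` ⟹
  `∃ BR, RefCfgCoherent BR ∧ CfgRefOwnΦ D B BR dist b₀ p₀ a (C_B/(1−(L⁻¹)^a))`.  Unlike the kernel side there is NO dummy-level gap: the Cfg rows' own constraint `j < K − n` keeps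
  every index at a genuine level, where `LocMatched` applies.
* §3 **`exists_cfgRefΦ_canonCore_of_twoRun`**: at the χ-record's canonical polymerisation (`locMatched_canonCore`, `canonLegDist_matched`, `cfgRefΦ_canonCore_of_own`) the row of
  record `CfgDistCauchyΦ (dataOfV3chi p …) B (canonLegDist F) 𝔠.b₀ 𝔠.p₀ a C_B` for ONE family gives `∃ BR, RefCfgCoherent BR ∧ CfgRefΦ … (C_B/(1−(L⁻¹)^a))` BY NAME.
HONEST FRAMING.  A CONSTRUCTOR ∕ REDUCTION; its hypothesis (one configuration family obeying the two-run row at every cut-off — [King1986] Prop. 3.9's comparison of the minimisers of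
two cut-offs, unprinted for non-abelian `d = 3`, the 19200-side content) is NOT asserted; meant for a canonical family (B0's `𝔖.Bcfg`), not for per-`K` choice witnesses (F-g4-1);
no stub, crux or registry object is touched; no summit or sub-problem statement is proved; YM₃ on T³ is a ladder rung (R3), not the Clay problem ∕ 𝕋⁴ ∕ a mass gap.

References: C. King, CMP 102 (1986) 649–677 [King1986] ((3.13) p.657, Prop. 3.9 (3.71)–(3.74) p.665); T. Bałaban, CMP 102 (1985) 255–275 [Balaban1985UV3] ((24) p.262, (44) p.267);
CMP 109 (1987) 249–301 [Balaban1987RG1] ((0.1) p.251).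
-/

set_option autoImplicit false

noncomputable section

open Filter Topology
open scoped BigOperators
open Literature.MathematicalPhysics.QuantumFieldTheory.Balaban1983to89
open Literature.MathematicalPhysics.QuantumFieldTheory.Balaban1983to89.T3ContinuumYM3Torus
open Literature.MathematicalPhysics.QuantumFieldTheory.Balaban1983to89.T3UnitScaleTilt
open Literature.MathematicalPhysics.QuantumFieldTheory.Balaban1983to89.T3LevelShift
open Literature.MathematicalPhysics.QuantumFieldTheory.Balaban1983to89.T3AlphaPolymerSocket
open Literature.MathematicalPhysics.QuantumFieldTheory.Balaban1983to89.T3AlphaInputsAC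
open Literature.MathematicalPhysics.QuantumFieldTheory.Balaban1983to89.T3CruxEstimates (plaqSmall_fieldShift)
open Literature.MathematicalPhysics.QuantumFieldTheory.Balaban1985CMP102
open Literature.MathematicalPhysics.QuantumFieldTheory.Balaban1985CMP102.Setting
open Summit.QuantumFields.Balaban3D.Carriers
open Summit.QuantumFields.Balaban3D.Proofs.Primitives
open Summit.QuantumFields.Balaban3D.Proofs.GroupModelLieC (lieC)
open Summit.QuantumFields.YangMills.Theorems
open Summit.QuantumFields.YangMills.Theorems.GlobalSlackKernelMatching
open Summit.QuantumFields.YangMills.Theorems.GlobalSlackKernelLeg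
open Summit.QuantumFields.YangMills.Theorems.GlobalSlackCanonicalPolymers
open Summit.QuantumFields.YangMills.Theorems.TwoCutoffTowerLimit

namespace Summit.QuantumFields.YangMills.Theorems.TwoCutoffRefCfgCoherent

/-! ## §1 Bookkeeping: level re-addressing, the budget along the step -/

section Congr

variable {𝕍 : Type} {F : T3Family}

/-- **LEVEL RE-ADDRESSING**: a configuration family read at a `fieldShift`ed field does not depend on which of two (propositionally) equal level indices addresses it
(`subst`; the two modulus equalities are then proofs of one proposition). [cite: Balaban1987RG1, (0.1) p.251] -/
theorem cfgFam_level_congr (B : CfgFam 𝕍 F) {K k₁ k₂ j : ℕ} (e : k₁ = k₂) (Y : Set (Site (F.P K) 0)) {m₀ K₀ k₀ : ℕ}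
    (W : GaugeField (F.PP m₀ K₀) k₀ (Matrix.specialUnitaryGroup (Fin 2) ℂ))
    (h₁ : (F.PP F.m K).sitesPerDir k₁ = (F.PP m₀ K₀).sitesPerDir k₀) (h₂ : (F.PP F.m K).sitesPerDir k₂ = (F.PP m₀ K₀).sitesPerDir k₀) (c : PBond (F.P K) j) :
    B K k₁ j Y (fieldShift h₁ W) c = B K k₂ j Y (fieldShift h₂ W) c := by
  subst e; rfl

end Congr

section Bookkeeping

variable {F : T3Family} {γ : ℝ}

/-- **THE Cfg BUDGET ALONG THE STEP** (matched distances): with `ε K k j Y c := C_B·(1 + d_K(c))·θ(K−k)·(L^{−(k−1−j)})²·(L^{−(1+j)})^a`, one step of the tower multiplies it by exactly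
`(L⁻¹)^a` (`k ≤ K`, `1 ≤ L`). [cite: King1986, Prop. 3.9 (3.71) p.665; Balaban1985UV3, (44) p.267] -/
theorem cfgBudget_step_eq {dist : LegDist F} (hm : DistMatched dist) (hL : 1 ≤ F.L) (b₀ p₀ a C_B : ℝ) {K k j : ℕ} (hk : k ≤ K) (Y : Set (Site (F.P K) 0))
    (c : PBond (F.P K) j) :
    C_B * (1 + dist (K + 1) (j + 1) (refineSet F K Y) (matchBond F K j c)) * θBal F.L γ b₀ p₀ (K + 1 - (k + 1)) *
        (((F.L : ℝ) ^ (k + 1 - 1 - (j + 1)))⁻¹) ^ 2 * (((F.L : ℝ) ^ (1 + (j + 1)))⁻¹) ^ a =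
      ((F.L : ℝ)⁻¹) ^ a * (C_B * (1 + dist K j Y c) * θBal F.L γ b₀ p₀ (K - k) * (((F.L : ℝ) ^ (k - 1 - j))⁻¹) ^ 2 * (((F.L : ℝ) ^ (1 + j))⁻¹) ^ a) := by
  rw [hm K j Y c, show K + 1 - (k + 1) = K - k by omega, show k + 1 - 1 - (j + 1) = k - 1 - j by omega, TwoCutoffKerHeightFree.rate_succ_eq hL a j]
  ring

end Bookkeeping

/-! ## §2 The coherent reference functional from a one-family two-run row -/

section Construct

variable {𝕍 : Type} [NormedAddCommGroup 𝕍] [CompleteSpace 𝕍] {F : T3Family} {γ : ℝ}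

/-- **THE COHERENT REFERENCE CONFIGURATION FUNCTIONAL FROM A ONE-FAMILY TWO-RUN ROW.**  `LocMatched D`, `DistMatched dist`, `1 < L`, `0 < a` and the two-run row
`CfgDistCauchyΦ D B dist b₀ p₀ a C_B` of ONE configuration family `B` ⟹ there is a reference functional `BR` with `RefCfgCoherent BR` (EXACT matching across the refinement, for
every index) and the own-indexed per-run closeness `CfgRefOwnΦ D B BR dist b₀ p₀ a (C_B/(1 − (L⁻¹)^a))` — the converse of `cfgDistCauchyΦ_of_ref`: [King1986] Prop. 3.9 read as «each
run's background is within `L^{−γk}` of ONE limiting background», obtained from the two-cut-off comparison (file 1's `exists_coherent_family` on the tower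
`(K, k, j, Y, W, c) ↦ (K+1, k+1, j+1, refineSet Y, fieldShift W, matchBond c)`, fibre `𝕍`, identity pull-backs). [cite: King1986, (3.13) p.657, Prop. 3.9 (3.71)-(3.72) p.665; Balaban1985UV3, (44) p.267; Balaban1987RG1, (0.1) p.251] -/
theorem exists_refCfgCoherent_of_twoRun {D : AlphaDataT3 F γ} (hLoc : LocMatched D) (B : CfgFam 𝕍 F) {dist : LegDist F} (hm : DistMatched dist)
    {b₀ p₀ a C_B : ℝ} (ha : 0 < a) (hL : 1 < F.L) (hrow : CfgDistCauchyΦ D B dist b₀ p₀ a C_B) :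
    ∃ BR : CfgFam 𝕍 F, RefCfgCoherent BR ∧ CfgRefOwnΦ D B BR dist b₀ p₀ a (C_B / (1 - ((F.L : ℝ)⁻¹) ^ a)) := by
  have hL1 : 1 ≤ F.L := hL.le
  set ρ : ℝ := ((F.L : ℝ)⁻¹) ^ a with hρdef
  have hρ : ρ < 1 := TwoCutoffKerHeightFree.ratio_lt_one hL ha
  have h1ρ : 0 < 1 - ρ := by linarith
  -- index set: (run, lattice level, chart index, domain, level-`k` field, bond); constant fibre `𝕍`; identity pull-backs
  let ι : Type := Σ K : ℕ, Σ k : ℕ, Σ j : ℕ, Σ _Y : Set (Site (F.P K) 0), Σ _W : GaugeField (F.P K) k (Matrix.specialUnitaryGroup (Fin 2) ℂ), PBond (F.P K) j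
  let s : ι → ι := fun i => ⟨i.1 + 1, i.2.1 + 1, i.2.2.1 + 1, refineSet F i.1 i.2.2.2.1,
    fieldShift (F.sitesPerDir_eq (m := F.m) (K := i.1 + 1) (j := i.2.1 + 1) (m' := F.m) (K' := i.1) (j' := i.2.1) (by omega)) i.2.2.2.2.1,
    matchBond F i.1 i.2.2.1 i.2.2.2.2.2⟩
  let P : ι → Prop := fun i => i.2.1 ≤ i.1 ∧ i.2.2.1 < i.2.1 ∧ i.2.2.2.1 ∈ D.Loc i.1 i.2.1 (D.triv i.1 i.2.1) (1 + i.2.2.1) ∧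
    PlaqSmall (θBal F.L γ b₀ p₀ (i.1 - i.2.1)) i.2.2.2.2.1
  let M : ι → 𝕍 := fun i => B i.1 i.2.1 i.2.2.1 i.2.2.2.1 i.2.2.2.2.1 i.2.2.2.2.2
  let ε : ι → ℝ := fun i => C_B * (1 + dist i.1 i.2.2.1 i.2.2.2.1 i.2.2.2.2.2) * θBal F.L γ b₀ p₀ (i.1 - i.2.1) *
    (((F.L : ℝ) ^ (i.2.1 - 1 - i.2.2.1))⁻¹) ^ 2 * (((F.L : ℝ) ^ (1 + i.2.2.1))⁻¹) ^ a
  -- forward closure of `P` (`LocMatched` at height `K − k`; the window is shift-invariant)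
  have hP : ∀ i, P i → P (s i) := by
    rintro ⟨K, k, j, Y, W, c⟩ ⟨hk, hj, hY, hW⟩
    dsimp only at hk hj hY hW
    refine ⟨show k + 1 ≤ K + 1 by omega, show j + 1 < k + 1 by omega, ?_, ?_⟩
    · show refineSet F K Y ∈ D.Loc (K + 1) (k + 1) (D.triv (K + 1) (k + 1)) (1 + (j + 1))
      have hmaps := (hLoc K (K - k) (by omega) (1 + j) (by omega) (by omega)).mapsTo
      rw [show K - (K - k) = k by omega, show K + 1 - (K - k) = k + 1 by omega] at hmaps
      rw [show 1 + (j + 1) = 1 + j + 1 by ring]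
      exact Finset.mem_coe.mp (hmaps (Finset.mem_coe.mpr hY))
    · show PlaqSmall (θBal F.L γ b₀ p₀ (K + 1 - (k + 1))) (fieldShift _ W)
      rw [show K + 1 - (k + 1) = K - k by omega, plaqSmall_fieldShift]
      exact hW
  -- the row, re-addressed at `(K, k) = (K, K − n)`
  have hM : ∀ i, P i → ‖M (s i) - M i‖ ≤ ε i := by
    rintro ⟨K, k, j, Y, W, c⟩ ⟨hk, hj, hY, hW⟩
    dsimp only at hk hj hY hW
    -- the unit field at height `K − k` of which `W` is the shift
    have hV : (F.PP F.m (K - k)).sitesPerDir 0 = (F.PP F.m K).sitesPerDir k := F.sitesPerDir_eq (by omega)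
    have hY' : Y ∈ D.Loc K (K - (K - k)) (D.triv K (K - (K - k))) (1 + j) := by rwa [show K - (K - k) = k by omega]
    have hW' : PlaqSmall (θBal F.L γ b₀ p₀ (K - k)) (fieldShift hV W) := (plaqSmall_fieldShift F hV _ W).mpr hW
    have h := hrow K (K - k) (by omega) j (by omega) (fieldShift hV W) hW' Y hY' c
    rw [fieldShift_fieldShift, fieldShift_fieldShift,
      cfgFam_level_congr B (show K + 1 - (K - k) = k + 1 by omega) (refineSet F K Y) W _
        (F.sitesPerDir_eq (m := F.m) (K := K + 1) (j := k + 1) (m' := F.m) (K' := K) (j' := k) (by omega)) (matchBond F K j c),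
      cfgFam_level_congr B (show K - (K - k) = k by omega) Y W _ (Eq.refl _) c, fieldShift_refl,
      show K - (K - k) - 1 - j = k - 1 - j by omega] at h
    exact h
  obtain ⟨N, hcoh, -, hb⟩ := exists_coherent_family (V := fun _ : ι => 𝕍) s (fun _ x => x) (fun _ x y => le_rfl) (fun _ => rfl)
    (fun _ => Set.univ) (fun _ => isClosed_univ) (fun _ => Set.mem_univ _) (fun _ _ _ => Set.mem_univ _) P hP M (fun _ _ => Set.mem_univ _)
    ε (fun i => ε i / (1 - ρ)) hM
    (by
      rintro ⟨K, k, j, Y, W, c⟩ ⟨hk, -, -, -⟩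
      dsimp only at hk
      have hstep : ε (s ⟨K, k, j, Y, W, c⟩) = ρ * ε ⟨K, k, j, Y, W, c⟩ := cfgBudget_step_eq hm hL1 b₀ p₀ a C_B hk Y c
      show ε ⟨K, k, j, Y, W, c⟩ + ε (s ⟨K, k, j, Y, W, c⟩) / (1 - ρ) ≤ ε ⟨K, k, j, Y, W, c⟩ / (1 - ρ)
      rw [hstep, show ε ⟨K, k, j, Y, W, c⟩ + ρ * ε ⟨K, k, j, Y, W, c⟩ / (1 - ρ) = ε ⟨K, k, j, Y, W, c⟩ / (1 - ρ) by field_simp; ring])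
    (by
      rintro i hi
      exact div_nonneg ((norm_nonneg _).trans (hM i hi)) h1ρ.le)
  refine ⟨fun K k j Y W c => N ⟨K, k, j, Y, W, c⟩, ?_, ?_⟩
  · -- `RefCfgCoherent`: exact coherence, re-addressed from level `K − n + 1` to `K + 1 − n`
    intro K n hn j hj V Y c
    have h0 : (F.PP F.m K).sitesPerDir (K - n) = (F.PP F.m n).sitesPerDir 0 :=
      F.sitesPerDir_eq (m := F.m) (K := K) (j := K - n) (m' := F.m) (K' := n) (j' := 0) (by omega)
    have hc := hcoh ⟨K, K - n, j, Y, fieldShift h0 V, c⟩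
    -- `hc : N (s i₀) = N i₀`; the goal's right side is `N i₀`, its left side is `N (s i₀)` re-addressed from level `K − n + 1` to `K + 1 − n`
    refine Eq.trans ?_ hc
    show _ = N ⟨K + 1, K - n + 1, j + 1, refineSet F K Y,
      fieldShift (F.sitesPerDir_eq (m := F.m) (K := K + 1) (j := K - n + 1) (m' := F.m) (K' := K) (j' := K - n) (by omega)) (fieldShift h0 V),
      matchBond F K j c⟩
    rw [fieldShift_fieldShift]
    exact cfgFam_level_congr (fun K k j Y W c => N ⟨K, k, j, Y, W, c⟩) (show K + 1 - n = K - n + 1 by omega) (refineSet F K Y) V _ _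
      (matchBond F K j c)
  · -- `CfgRefOwnΦ`: the bound on `P`, at `(K, K − n)`
    intro K n hn j hj V hV Y hY c
    have h0 : (F.PP F.m K).sitesPerDir (K - n) = (F.PP F.m n).sitesPerDir 0 :=
      F.sitesPerDir_eq (m := F.m) (K := K) (j := K - n) (m' := F.m) (K' := n) (j' := 0) (by omega)
    have hPi : P ⟨K, K - n, j, Y, fieldShift h0 V, c⟩ := by
      refine ⟨show K - n ≤ K by omega, hj, hY, ?_⟩
      show PlaqSmall (θBal F.L γ b₀ p₀ (K - (K - n))) (fieldShift h0 V)
      rw [show K - (K - n) = n by omega, plaqSmall_fieldShift]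
      exact hV
    have h := hb _ hPi
    have hshape : ε ⟨K, K - n, j, Y, fieldShift h0 V, c⟩ / (1 - ρ) =
        C_B / (1 - ρ) * (1 + dist K j Y c) * θBal F.L γ b₀ p₀ n * (((F.L : ℝ) ^ (K - n - 1 - j))⁻¹) ^ 2 * (((F.L : ℝ) ^ (1 + j))⁻¹) ^ a := by
      show C_B * (1 + dist K j Y c) * θBal F.L γ b₀ p₀ (K - (K - n)) * (((F.L : ℝ) ^ (K - n - 1 - j))⁻¹) ^ 2 * (((F.L : ℝ) ^ (1 + j))⁻¹) ^ a / (1 - ρ) = _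
      rw [show K - (K - n) = n by omega]
      ring
    rw [hshape] at h
    exact h

end Construct

/-! ## §3 At the χ-record's canonical polymerisation: `CfgRefΦ` by name -/

section Canon

variable {F : T3Family} {𝔠 : AlphaConsts F.L (suGroupModel 2).N} {γ : ℝ} {hγ : 0 < γ} {hγ1 : γ ≤ (min 𝔠.gamma0 1) ^ 2}

/-- **THE Cfg ROW OF RECORD FOR ONE FAMILY ⟹ THE REFERENCE FORM OF RECORD, BY NAME** (χ-record's canonical polymerisation, canonical leg distance; `0 ≤ C_B`, `0 < a`):
`CfgDistCauchyΦ D B (canonLegDist F) 𝔠.b₀ 𝔠.p₀ a C_B` for ONE configuration family `B : CfgFam ↥𝔤 F` ⟹ `∃ BR, RefCfgCoherent BR ∧ CfgRefOwnΦ … ∧ CfgRefΦ D B BR (canonLegDist F) 𝔠.b₀ 𝔠.p₀ a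
(C_B/(1−(L⁻¹)^a))` (`locMatched_canonCore`, `canonLegDist_matched`, `cfgRefΦ_canonCore_of_own`) — so `cfgDistCauchyΦ_of_ref` returns the two-run row with constant `2C_B/(1−(L⁻¹)^a)`:
the two Cfg currencies of `K1aLegRowsRefChi` / `K1aLegRowsRChi` are interchangeable for one family.  HONEST: a reduction; the row itself (the 19200-side two-cut-off comparison of the
minimisers) is not asserted. [cite: King1986, Prop. 3.9 (3.71)-(3.72) p.665; Balaban1985UV3, (44) p.267; Balaban1987RG1, (0.1) p.251] -/
theorem exists_cfgRefΦ_canonCore_of_twoRun (p : ∀ K, AlphaInputsT3AC.PkgAtV3Chi F 𝔠 γ hγ hγ1 K) (B : CfgFam ↥(lieC (suGroupModel 2)) F)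
    {a C_B : ℝ} (ha : 0 < a) (hCB : 0 ≤ C_B)
    (hrow : CfgDistCauchyΦ (AlphaInputsT3AC.dataOfV3chi p (canonPolymerCore fun K => (p K).toCore)) B (canonLegDist F) 𝔠.b₀ 𝔠.p₀ a C_B) :
    ∃ BR : CfgFam ↥(lieC (suGroupModel 2)) F, RefCfgCoherent BR ∧
      CfgRefOwnΦ (AlphaInputsT3AC.dataOfV3chi p (canonPolymerCore fun K => (p K).toCore)) B BR (canonLegDist F) 𝔠.b₀ 𝔠.p₀ a (C_B / (1 - ((F.L : ℝ)⁻¹) ^ a)) ∧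
      CfgRefΦ (AlphaInputsT3AC.dataOfV3chi p (canonPolymerCore fun K => (p K).toCore)) B BR (canonLegDist F) 𝔠.b₀ 𝔠.p₀ a (C_B / (1 - ((F.L : ℝ)⁻¹) ^ a)) := by
  have hL : 1 < F.L := F.hL.2
  obtain ⟨BR, hcoh, hown⟩ := exists_refCfgCoherent_of_twoRun (locMatched_canonCore fun K => (p K).toCore) B (canonLegDist_matched F) ha hL hrow
  have hC' : 0 ≤ C_B / (1 - ((F.L : ℝ)⁻¹) ^ a) := div_nonneg hCB (by linarith [TwoCutoffKerHeightFree.ratio_lt_one hL ha])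
  exact ⟨BR, hcoh, hown, cfgRefΦ_canonCore_of_own p hC' ha.le hown⟩

end Canon

end Summit.QuantumFields.YangMills.Theorems.TwoCutoffRefCfgCoherent

end
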